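import Mathlib
import Literature.Topology.FourManifolds.PlanarAchiralWords
import Literature.Topology.FourManifolds.PlanarShadowWalk
import Summits.SmoothPoincare4.SmoothPoincare4.Theorems.ConvexBisectionPlanarAcyclicBisectionRigidityHelperConjugationThree
import Summits.SmoothPoincare4.SmoothPoincare4.Theorems.ConvexBisectionPlanarAcyclicBisectionRigidityHelperTwoHoleNormalFormThree
import Summits.SmoothPoincare4.SmoothPoincare4.Theorems.ConvexBisectionPlanarAcyclicBisectionRigidityStubK4Lift
import Summits.SmoothPoincare4.SmoothPoincare4.Theorems.ConvexBisectionPlanarAcyclicBisectionRigidityHelperWalkLowLevel3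
import Summits.SmoothPoincare4.SmoothPoincare4.Theorems.ConvexBisectionPlanarAcyclicBisectionRigidityHelperAbelianArcData
import HarnessLib

/-!
# Crux `ConvexBisection.PlanarAcyclicBisectionRigidity`, line Sketch v3.0 — `stub_walk3`, part 1:
# twist-level bookkeeping of the level-3 moves

Combinatorics of the registered planar word calculus `PlanarWords` (`PlanarAchiralWords.lean`) on
THREE holes, read through the twist units `ReachMon.T 3 l : (ArcData 3)ˣ` of the letters
(`…HelperReachMon.lean`).  Everything is proved; nothing topological is asserted.  These are the moves
the lead's assembly of `stub_walk3` ("every integral homotopy-sphere word on three holes, in any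
spelling, walks to an honest double at level 3") performs BEFORE handing the word to the twist-level
lift of the `F₂` lever (`helper_twistLift3`):

* `Walk3.T_central_*` — the twist of a single-hole / three-hole letter is a hole twist `T_[j,j]` /
  the outer twist `T_[0,2]` (`Conj3.holeTwist_conj`, `outerTwist_conj3`, p144731), and such CENTRAL
  twists commute with the twist of every in-range letter;
* `Walk3.move_central_left` / `move_central_right` — a letter with central twist walks one step to
  the left (Hurwitz move) / to the right (inverse Hurwitz move) WITHOUT touching the letter it passes
  (only its own spelling changes, its twist does not);
* `Walk3.swap_pos` / `swap_neg` — two adjacent positive (resp. negative) letters whose twists are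
  evaluations of words in the round sub-alphabet (`IsXYGen`, with `F₂` shadows `p`, `q`) are swapped by
  one Hurwitz move; the moved-over letter keeps its spelling, the other acquires an XY-expressible
  twist with the conjugated shadow;
* `Walk3.kind_*` — the XY-data of the syntactic shapes `⟨0,1,h⟩`, `⟨1,2,h⟩` delivered by
  `twoHoleTwist_normalForm3` (p147003), their hole types, and the transfer of hole types along equal
  twists (`typeVec_eq_of_twist_eq3`, from `AbArc.ev_u_twist`).
-/

noncomputable section

open Literature.Topology.FourManifolds Literature.Topology.FourManifolds.PlanarWords
open Literature.Topology.FourManifolds.PlanarShadow (F₂ gx gy IsXYGen shadowWord shadowGen shadowCurve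
  shadowLetter shadowWord_append shadowWord_nil)

-- the prescribed namespace `Summit.<S>.<P>.…` repeats `SmoothPoincare4` (S = P = SmoothPoincare4)
set_option linter.dupNamespace false

namespace Summit.SmoothPoincare4.SmoothPoincare4.Theorems.PlanarAcyclicBisectionRigidity.Sketch

namespace Walk3

open ArcData PGen WalkLow SeamNG ReachMon Conj3

/-! ## Twist units of letters -/

/-- The twist unit of a positive letter, as arc data, is the evaluation of its twist word
(definitional). [folklore] -/
theorem T_val_true (c : PlanarCurve) :
    ((T 3 (c, true) : (ArcData 3)ˣ) : ArcData 3) = evalWord 3 (c.twistWord true) := rfl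

/-- Two positive letters with equal twist arc data have equal twist units. [folklore] -/
theorem T_eq_of_eval_eq {c d : PlanarCurve}
    (h : evalWord 3 (c.twistWord true) = evalWord 3 (d.twistWord true)) : T 3 (c, true) = T 3 (d, true) :=
  Units.ext h

/-- The twist unit of a positive letter whose twist evaluates like a word `g` is the unit of `g`.
[folklore] -/
theorem T_eq_U_of_eval {c : PlanarCurve} {g : List PGen}
    (h : evalWord 3 (c.twistWord true) = evalWord 3 g) : T 3 (c, true) = U 3 g :=
  Units.ext h

/-- Twist units do not permute the holes. [folklore] -/
theorem T_perm (l : Letter) : ((T 3 l : (ArcData 3)ˣ) : ArcData 3).perm = 1 := by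
  obtain ⟨c, s⟩ := l
  cases s
  · rw [T_false]
    have h : ((T 3 (c, true) : (ArcData 3)ˣ) : ArcData 3).perm *
        ((↑(T 3 (c, true))⁻¹ : (ArcData 3)ˣ) : ArcData 3).perm = 1 := by
      rw [← mul_perm]
      show ((T 3 (c, true) * (T 3 (c, true))⁻¹ : (ArcData 3)ˣ) : ArcData 3).perm = 1
      rw [mul_inv_cancel]; rfl
    rw [T_val_true, twist_perm, one_mul] at h
    exact h
  · exact twist_perm c

/-- The twist word of an in-range letter is supported on the three holes. [folklore] -/
theorem twistWord_below {c : PlanarCurve} (hc : c.InRange 3) (s : Bool) :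
    ∀ q ∈ c.twistWord s, q.below 3 = true := by
  obtain ⟨hab, hb, hg⟩ := hc
  intro q hq
  simp only [PlanarCurve.twistWord, List.mem_append, List.mem_singleton] at hq
  rcases hq with (hq | rfl) | hq
  · exact hg q hq
  · simp [PGen.below, hb]
  · simp only [invWord, List.mem_reverse, List.mem_map] at hq
    obtain ⟨p, hp, rfl⟩ := hq
    have := hg p hp
    cases p <;> simpa [PGen.inv, PGen.below] using this

/-! ## Central twists: hole twists and the outer twist -/

/-- **A single-hole letter has a hole twist**: `T_{g(c_[a,a])} = T_[π_g a, π_g a]`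
(`Conj3.holeTwist_conj`). [folklore] -/
theorem T_central_single {c : PlanarCurve} (hc : c.InRange 3) (h : c.a = c.b) :
    ∃ j : Fin 3, T 3 (c, true) = U 3 [round j.val j.val false] := by
  obtain ⟨a, b, g⟩ := c
  obtain ⟨hab, hb, hg⟩ := hc
  simp only at hab hb h
  subst h
  refine ⟨(evalWord 3 g).perm ⟨a, hb⟩, Units.ext ?_⟩
  show evalWord 3 (g ++ [round a a (!true)] ++ invWord g) = evalWord 3 _
  exact holeTwist_conj g ⟨a, hb⟩

/-- **A three-hole letter has the outer twist**: `T_{g(c_[0,2])} = T_[0,2]` (`outerTwist_conj3`).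
[folklore] -/
theorem T_central_outer {c : PlanarCurve} (hc : c.InRange 3) (h0 : c.a = 0) (h2 : c.b = 2) :
    T 3 (c, true) = U 3 [round 0 2 false] := by
  obtain ⟨a, b, g⟩ := c
  obtain ⟨hab, hb, hg⟩ := hc
  simp only at h0 h2 hg
  subst h0; subst h2
  refine Units.ext ?_
  show evalWord 3 (g ++ [round 0 2 (!true)] ++ invWord g) = evalWord 3 _
  exact outerTwist_conj3 g hg

/-- **Central twists commute with the twist of every in-range letter.**  Here "central" means: the
positive twist of `d` is a hole twist `T_[j,j]` or the outer twist `T_[0,2]`. [folklore] -/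
theorem commute_central {d : PlanarCurve}
    (hd : (∃ j : Fin 3, T 3 (d, true) = U 3 [round j.val j.val false]) ∨
      T 3 (d, true) = U 3 [round 0 2 false])
    (s : Bool) (l : Letter) (hl : l.1.InRange 3) : Commute (T 3 (d, s)) (T 3 l) := by
  have key : Commute (T 3 (d, true)) (T 3 l) := by
    rcases hd with ⟨j, hj⟩ | hj
    · rw [hj]
      exact commute_hole j.val j.isLt false (T 3 l) (T_perm l)
    · rw [hj]
      obtain ⟨c, t⟩ := l
      show Commute (U 3 [round 0 2 false]) (U 3 (c.twistWord t))
      exact commute_outer false _ (twistWord_below hl t)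
  cases s
  · rw [T_false]; exact key.inv_left
  · exact key

/-! ## Moving a central letter, one step -/

/-- **A central letter walks one step to the LEFT without touching the letter it passes**: the
Hurwitz move `(x, d) ↦ (T_x^{±}(d), x)`; the new spelling `d′` of the central letter has the same
sign and the same twist (central twists commute with `T_x`), and is in range. [folklore] -/
theorem move_central_left (pre post : List Letter) (x d : Letter)
    (hd : (∃ j : Fin 3, T 3 (d.1, true) = U 3 [round j.val j.val false]) ∨
      T 3 (d.1, true) = U 3 [round 0 2 false])
    (hx : x.1.InRange 3) (hdr : d.1.InRange 3) :
    ∃ d' : Letter, d'.2 = d.2 ∧ T 3 (d'.1, true) = T 3 (d.1, true) ∧ d'.1.InRange 3 ∧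
      Reachable (3, pre ++ x :: d :: post) (3, pre ++ d' :: x :: post) := by
  refine ⟨hurwitzAct x d, rfl, ?_, WalkLevel3.inRange_hurwitzAct hx hdr,
    (Move.hurwitz 3 pre post x d).reachable⟩
  -- the twist of the moved letter is unchanged: `T_x T_d T_x⁻¹ = T_d`
  have hT : T 3 (hurwitzAct x d) = T 3 d := by
    rw [T_hurwitzAct, (commute_central hd d.2 x hx).symm.eq, mul_inv_cancel_right]
  obtain ⟨c, s⟩ := d
  cases s
  · -- negative letter: compare the inverses
    have h1 : T 3 ((hurwitzAct x (c, false)).1, false) = T 3 (c, false) := hT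
    rw [T_false, T_false] at h1
    exact inv_injective h1
  · exact hT

/-- **A central letter walks one step to the RIGHT without touching the letter it passes**: the
inverse Hurwitz move `(d, x) ↦ (x, T_x^{∓}(d))`. [folklore] -/
theorem move_central_right (pre post : List Letter) (d x : Letter)
    (hd : (∃ j : Fin 3, T 3 (d.1, true) = U 3 [round j.val j.val false]) ∨
      T 3 (d.1, true) = U 3 [round 0 2 false])
    (hx : x.1.InRange 3) (hdr : d.1.InRange 3) :
    ∃ d' : Letter, d'.2 = d.2 ∧ T 3 (d'.1, true) = T 3 (d.1, true) ∧ d'.1.InRange 3 ∧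
      Reachable (3, pre ++ d :: x :: post) (3, pre ++ x :: d' :: post) := by
  have hx' : (x.1, !x.2).1.InRange 3 := hx
  refine ⟨hurwitzAct (x.1, !x.2) d, rfl, ?_, WalkLevel3.inRange_hurwitzAct hx' hdr,
    (Move.hurwitzInv 3 pre post d x).reachable⟩
  have hT : T 3 (hurwitzAct (x.1, !x.2) d) = T 3 d := by
    rw [T_hurwitzAct, (commute_central hd d.2 (x.1, !x.2) hx').symm.eq, mul_inv_cancel_right]
  obtain ⟨c, s⟩ := d
  cases s
  · have h1 : T 3 ((hurwitzAct (x.1, !x.2) (c, false)).1, false) = T 3 (c, false) := hT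
    rw [T_false, T_false] at h1
    exact inv_injective h1
  · exact hT

/-! ## XY-expressible twists: swapping two adjacent essential letters -/

/-- The round sub-alphabet is supported on the three holes. [folklore] -/
theorem below_of_xy' {g : List PGen} (hg : ∀ q ∈ g, IsXYGen q) : ∀ q ∈ g, q.below 3 = true :=
  fun q hq => below_of_xy (hg q hq)

/-- **Swapping two adjacent POSITIVE essential letters** `(y⁺, x⁺) ↦ (T_y(x)⁺, y⁺)`: the moved-over
letter `y` keeps its spelling; the new letter's twist is `T_y T_x T_y⁻¹`, again the evaluation of a
word in the round sub-alphabet, with shadow `q p q⁻¹`. [folklore] -/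
theorem swap_pos (pre post : List Letter) (cy cx : PlanarCurve) (gy gx' : List PGen)
    (hgy : ∀ q ∈ gy, IsXYGen q) (hgx : ∀ q ∈ gx', IsXYGen q)
    (hy : evalWord 3 (cy.twistWord true) = evalWord 3 gy)
    (hx : evalWord 3 (cx.twistWord true) = evalWord 3 gx')
    (hcy : cy.InRange 3) (hcx : cx.InRange 3) :
    ∃ cx' : PlanarCurve, cx'.InRange 3 ∧
      evalWord 3 (cx'.twistWord true) = evalWord 3 (gy ++ gx' ++ invWord gy) ∧
      (∀ q ∈ gy ++ gx' ++ invWord gy, IsXYGen q) ∧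
      shadowWord (gy ++ gx' ++ invWord gy) = shadowWord gy * shadowWord gx' * (shadowWord gy)⁻¹ ∧
      Reachable (3, pre ++ (cy, true) :: (cx, true) :: post) (3, pre ++ (cx', true) :: (cy, true) :: post) := by
  refine ⟨(hurwitzAct (cy, true) (cx, true)).1, WalkLevel3.inRange_hurwitzAct hcy hcx, ?_, ?_, ?_,
    (Move.hurwitz 3 pre post (cy, true) (cx, true)).reachable⟩
  · -- twists: `T_{T_y(x)} = T_y T_x T_y⁻¹ = U(g_y g_x g_y⁻¹)`
    have h := T_hurwitzAct (n := 3) (cy, true) (cx, true)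
    rw [T_eq_U_of_eval hy, T_eq_U_of_eval hx, ← U_invWord, ← U_append, ← U_append] at h
    exact congrArg Units.val h
  · intro q hq
    simp only [List.mem_append] at hq
    rcases hq with (hq | hq) | hq
    · exact hgy q hq
    · exact hgx q hq
    · exact K4Lift.xy_invWord hgy q hq
  · rw [shadowWord_append, shadowWord_append, K4Lift.sw_inv hgy]

/-- **Swapping two adjacent NEGATIVE essential letters** `(x⁻, y⁻) ↦ (T_x⁻¹(y)⁻, x⁻)`: the moved-over
letter `x` keeps its spelling; the new letter's POSITIVE twist is `T_x⁻¹ T_y T_x`, the evaluation of a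
word in the round sub-alphabet with shadow `p⁻¹ q p`. [folklore] -/
theorem swap_neg (pre post : List Letter) (cx cy : PlanarCurve) (gx' gy : List PGen)
    (hgx : ∀ q ∈ gx', IsXYGen q) (hgy : ∀ q ∈ gy, IsXYGen q)
    (hx : evalWord 3 (cx.twistWord true) = evalWord 3 gx')
    (hy : evalWord 3 (cy.twistWord true) = evalWord 3 gy)
    (hcx : cx.InRange 3) (hcy : cy.InRange 3) :
    ∃ cy' : PlanarCurve, cy'.InRange 3 ∧
      evalWord 3 (cy'.twistWord true) = evalWord 3 (invWord gx' ++ gy ++ gx') ∧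
      (∀ q ∈ invWord gx' ++ gy ++ gx', IsXYGen q) ∧
      shadowWord (invWord gx' ++ gy ++ gx') = (shadowWord gx')⁻¹ * shadowWord gy * shadowWord gx' ∧
      Reachable (3, pre ++ (cx, false) :: (cy, false) :: post) (3, pre ++ (cy', false) :: (cx, false) :: post) := by
  refine ⟨(hurwitzAct (cx, false) (cy, false)).1, WalkLevel3.inRange_hurwitzAct hcx hcy, ?_, ?_, ?_,
    (Move.hurwitz 3 pre post (cx, false) (cy, false)).reachable⟩
  · -- `T_x⁻¹(y) = image (T_x⁻¹-word) y`, so its positive twist is `T_x⁻¹ · T_y · T_x` as units of words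
    have e : (hurwitzAct (cx, false) (cy, false)).1 =
        PlanarCurve.image (Letter.twistWord (cx, false)) cy := rfl
    have h : T 3 ((hurwitzAct (cx, false) (cy, false)).1, true) = U 3 (invWord gx' ++ gy ++ gx') := by
      rw [e, T_image]
      show T 3 (cx, false) * T 3 (cy, true) * (T 3 (cx, false))⁻¹ = _
      rw [T_false, T_eq_U_of_eval hx, T_eq_U_of_eval hy, ← U_invWord, ← U_invWord, invWord_invWord,
        ← U_append, ← U_append]
    exact congrArg Units.val h
  · intro q hq
    simp only [List.mem_append] at hq
    rcases hq with (hq | hq) | hq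
    · exact K4Lift.xy_invWord hgx q hq
    · exact hgy q hq
    · exact hgx q hq
  · rw [shadowWord_append, shadowWord_append, K4Lift.sw_inv hgx]

/-! ## The syntactic shapes of `twoHoleTwist_normalForm3` -/

/-- `⟨0,1,h⟩` with `h` in the round sub-alphabet is a good curve of `K4Lift`. [folklore] -/
theorem good01 {h : List PGen} (hh : ∀ q ∈ h, IsXYGen q) : (⟨0, 1, h⟩ : PlanarCurve) ∈ K4Lift.GoodC :=
  ⟨Or.inl ⟨rfl, rfl⟩, hh⟩

/-- `⟨1,2,h⟩` with `h` in the round sub-alphabet is a good curve of `K4Lift`. [folklore] -/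
theorem good12 {h : List PGen} (hh : ∀ q ∈ h, IsXYGen q) : (⟨1, 2, h⟩ : PlanarCurve) ∈ K4Lift.GoodC :=
  ⟨Or.inr ⟨rfl, rfl⟩, hh⟩

/-- **XY-data of the shape `⟨0,1,h⟩`**: its positive twist word lies in the round sub-alphabet and has
shadow `h̄ x h̄⁻¹`. [folklore] -/
theorem kind01 {h : List PGen} (hh : ∀ q ∈ h, IsXYGen q) :
    (∀ q ∈ (⟨0, 1, h⟩ : PlanarCurve).twistWord true, IsXYGen q) ∧
      shadowWord ((⟨0, 1, h⟩ : PlanarCurve).twistWord true) = shadowWord h * gx * (shadowWord h)⁻¹ := by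
  refine ⟨K4Lift.xy_twist (good01 hh) true, ?_⟩
  rw [K4Lift.sw_twist (good01 hh)]
  rfl

/-- **XY-data of the shape `⟨1,2,h⟩`**: its positive twist word lies in the round sub-alphabet and has
shadow `h̄ y h̄⁻¹`. [folklore] -/
theorem kind12 {h : List PGen} (hh : ∀ q ∈ h, IsXYGen q) :
    (∀ q ∈ (⟨1, 2, h⟩ : PlanarCurve).twistWord true, IsXYGen q) ∧
      shadowWord ((⟨1, 2, h⟩ : PlanarCurve).twistWord true) = shadowWord h * gy * (shadowWord h)⁻¹ := by
  refine ⟨K4Lift.xy_twist (good12 hh) true, ?_⟩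
  rw [K4Lift.sw_twist (good12 hh)]
  rfl

/-! ## Hole types -/

/-- **The hole type is determined by the twist** (on three holes, in-range curves): from
`AbArc.ev_u_twist` read at a hole inside the first curve. [folklore] -/
theorem typeVec_eq_of_twist_eq3 {c d : PlanarCurve} (hc : c.InRange 3)
    (h : evalWord 3 (c.twistWord true) = evalWord 3 (d.twistWord true)) :
    AbArc.typeVec 3 c = AbArc.typeVec 3 d := by
  -- a hole inside `c`
  have hne : AbArc.typeVec 3 c ≠ 0 := AbArc.typeVec_ne_zero c hc
  obtain ⟨i, hi0⟩ := Function.ne_iff.1 hne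
  have hi : AbArc.typeVec 3 c i = 1 := (AbArc.typeVec_zero_or_one c i).resolve_left hi0
  have hc' := AbArc.ev_u_twist (n := 3) c i
  have hd' := AbArc.ev_u_twist (n := 3) d i
  rw [h] at hc'
  rw [hc', if_pos hi] at hd'
  -- `hd' : typeVec c = if typeVec d i = 1 then typeVec d else 0`
  by_cases hdi : AbArc.typeVec 3 d i = 1
  · rw [if_pos hdi] at hd'; exact hd'
  · rw [if_neg hdi] at hd'; exact absurd hd' hne

/-- The hole type of the shape `⟨0,1,h⟩` (round sub-alphabet carrier) is `(1,1,0)`. [folklore] -/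
theorem typeVec01 {h : List PGen} (hh : ∀ q ∈ h, IsXYGen q) :
    AbArc.typeVec 3 ⟨0, 1, h⟩ = ![1, 1, 0] := by
  funext i
  rw [AbArc.typeVec_apply, show (evalWord 3 h).perm = 1 from perm_xy hh,
    show ((1 : Equiv.Perm (Fin 3)).symm i) = i from rfl]
  fin_cases i <;> simp

/-- The hole type of the shape `⟨1,2,h⟩` (round sub-alphabet carrier) is `(0,1,1)`. [folklore] -/
theorem typeVec12 {h : List PGen} (hh : ∀ q ∈ h, IsXYGen q) :
    AbArc.typeVec 3 ⟨1, 2, h⟩ = ![0, 1, 1] := by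
  funext i
  rw [AbArc.typeVec_apply, show (evalWord 3 h).perm = 1 from perm_xy hh,
    show ((1 : Equiv.Perm (Fin 3)).symm i) = i from rfl]
  fin_cases i <;> simp

/-- The hole type of the `{0,2}`-shape `⟨0,1,h · σ₁⟩` (round sub-alphabet carrier `h`) is `(1,0,1)`.
[folklore] -/
theorem typeVecZ {h : List PGen} (hh : ∀ q ∈ h, IsXYGen q) :
    AbArc.typeVec 3 ⟨0, 1, h ++ [sigma 1 false]⟩ = ![1, 0, 1] := by
  funext i
  rw [AbArc.typeVec_apply]
  have hp : (evalWord 3 (h ++ [sigma 1 false])).perm = Equiv.swap (1 : Fin 3) 2 := by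
    rw [evalWord_append, mul_perm, perm_xy hh, one_mul]
    rfl
  fin_cases i <;> simp [hp, Equiv.swap_apply_def]

/-- The hole type of a letter with a hole twist `T_[j,j]` spelt as `⟨j,j,[]⟩` is the unit vector.
[folklore] -/
theorem typeVec_single (j : Fin 3) :
    AbArc.typeVec 3 ⟨j.val, j.val, []⟩ = Pi.single j (1 : ℤ) := by
  funext i
  rw [AbArc.typeVec_apply, show (evalWord 3 ([] : List PGen)).perm = 1 from rfl,
    show ((1 : Equiv.Perm (Fin 3)).symm i) = i from rfl]
  by_cases hij : i = j
  · subst hij; simp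
  · rw [Pi.single_eq_of_ne hij, if_neg]
    have hv : i.val ≠ j.val := fun e => hij (Fin.ext e)
    rintro ⟨h1, h2⟩
    exact hv (le_antisymm (by simpa using h2) (by simpa using h1))

/-- The hole type of the outer shape `⟨0,2,[]⟩` is `(1,1,1)`. [folklore] -/
theorem typeVec_outer : AbArc.typeVec 3 ⟨0, 2, []⟩ = ![1, 1, 1] := by
  funext i
  rw [AbArc.typeVec_apply, show (evalWord 3 ([] : List PGen)).perm = 1 from rfl,
    show ((1 : Equiv.Perm (Fin 3)).symm i) = i from rfl]
  fin_cases i <;> simp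

end Walk3

open ReachMon in
/-- **Registered helper `helper_walk3_swapPos`** (= `Walk3.swap_pos`, the form the ledger records):
two adjacent positive letters of a level-3 word whose twists are evaluations of words in the round
sub-alphabet are swapped by one Hurwitz move, the moved-over letter keeping its spelling and the other
acquiring the conjugated XY-expressible twist. [folklore] -/
theorem helper_walk3_swapPos (pre post : List Letter) (cy cx : PlanarCurve) (gy gx' : List PGen)
    (hgy : ∀ q ∈ gy, IsXYGen q) (hgx : ∀ q ∈ gx', IsXYGen q)
    (hy : evalWord 3 (cy.twistWord true) = evalWord 3 gy)
    (hx : evalWord 3 (cx.twistWord true) = evalWord 3 gx')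
    (hcy : cy.InRange 3) (hcx : cx.InRange 3) :
    ∃ cx' : PlanarCurve, cx'.InRange 3 ∧
      evalWord 3 (cx'.twistWord true) = evalWord 3 (gy ++ gx' ++ invWord gy) ∧
      (∀ q ∈ gy ++ gx' ++ invWord gy, IsXYGen q) ∧
      shadowWord (gy ++ gx' ++ invWord gy) = shadowWord gy * shadowWord gx' * (shadowWord gy)⁻¹ ∧
      Reachable (3, pre ++ (cy, true) :: (cx, true) :: post) (3, pre ++ (cx', true) :: (cy, true) :: post) :=
  Walk3.swap_pos pre post cy cx gy gx' hgy hgx hy hx hcy hcx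

end Summit.SmoothPoincare4.SmoothPoincare4.Theorems.PlanarAcyclicBisectionRigidity.Sketch

end
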